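import Summits.KontsevichZagierPeriods.Zeta5Search.Barrier.ConeGammaRegularOpen

/-!
# ζ(5) search — BARRIER: on the Regular open-box stratum a bound `γ ≤ γ*` is decided by the INTEGER classes

HONEST FRAMING (cell `pub-zeta5`): systematic search; no irrationality claim unless kernel-certified. MODEL objects
under Brown–Zudilin's (28)+(30) accounting ([BZ22] = arXiv:2210.03391; (28) observed, not proved); a statement
about the sSup-form rate function `gamma` of `ConeGammaRates` on REAL directions versus INTEGER directions; nothing
here is a statement about the value of `γ` at any direction, the cone's supremum (C2 = `BarrierC2`, OPEN — the
census covers heights `2s₀ ≤ 60` only, the hypothesis below is about ALL integer classes), S-E (CONJECTURED) or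
`ζ(5)`. No number or sentence of record moves. Records in print UNMOVED. Prover P2 g23 (self-selected Lean-only item
«BZ's cubic (20) in the kernel», file 7: a corollary of `ConeGammaRegularOpen` — continuity of `γ` on the Regular
open-box stratum plus density of rational directions plus homogeneity).

The census prices INTEGER parameter vectors `a ∈ ℤ⁸` (classes); the barrier statement `ConeSupBound` is about REAL
directions. On the stratum where this seat's files make `γ` continuous — the Regular open-box directions with
non-zero worthiness denominator `Q = C₁ + δ₂₈ − Φ` — the two agree:
* `eventually_regular_openBox` — the stratum is open: near such a direction every direction is in it;
* `dense_ratDir` — directions with rational coordinates are dense in `Dir = ℝ⁸` (`dense_pi`, `Rat.denseRange_cast`);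
* `exists_intDir_of_ratDir` — a rational direction is a positive multiple of an integer one (clearing denominators);
* `stratum_smul`, — positive scaling preserves the open box, `Regular`, `Q ≠ 0`, and `γ` (`gamma_smul`);
* **`gamma_le_of_forall_intDir`** — IF `γ(realDir v) ≤ γ*` for every INTEGER vector `v` whose direction is in the
  open box, Regular, with `Q ≠ 0`, THEN `γ(a) ≤ γ*` for every REAL direction `a` of that stratum (by continuity of
  `γ` at `a`, `continuousAt_gamma_of_regular`, a rational direction near `a` would otherwise violate the bound, and
  it scales to an integer one with the same `γ`);
* **`gamma_le_of_forall_intDir_cone`** — the same with Brown–Zudilin's non-voidness margin: integer classes IN THE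
  CONE (`realDir v ∈ BZCone`) decide the bound at every real direction of the stratum with STRICT margin
  `s₀ < s₁ + ⋯ + s₇` (the face `s₀ = Σ sⱼ` is not covered).
READING (MODEL, methodology only): the supremum of `γ` over the Regular open-box stratum (`Q ≠ 0`) of the real
direction cone equals its supremum over the integer classes of ALL heights in that stratum; a finite census (heights
`≤ 60`) is evidence about, not a proof of, either.
-/

noncomputable section

open Set Metric Filter
open scoped Topology

namespace Summit.KontsevichZagierPeriods.Zeta5Search.Barrier.ConeGamma

/-- **The stratum is open**: near a Regular open-box direction with `Q ≠ 0`, every direction is one. -/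
theorem eventually_regular_openBox {a : Dir}
    (hopen : ∀ j : Fin 7, 0 < sParam a j.succ ∧ sParam a j.succ < sParam a 0) (hreg : Regular a)
    (hQ : C1 a + delta28 a - phi30 a ≠ 0) :
    ∀ᶠ a' in 𝓝 a, (∀ j : Fin 7, 0 < sParam a' j.succ ∧ sParam a' j.succ < sParam a' 0) ∧ Regular a' ∧
      C1 a' + delta28 a' - phi30 a' ≠ 0 := by
  have h1 : ∀ᶠ a' in 𝓝 a, (∀ j : Fin 7, 0 < sParam a' j.succ ∧ sParam a' j.succ < sParam a' 0) ∧ Regular a' :=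
    isOpen_regular_openBox.mem_nhds ⟨hopen, hreg⟩
  have hQc : ContinuousAt (fun b => C1 b + delta28 b - phi30 b) a :=
    ((continuousAt_C1_of_regular hopen hreg).add (continuousAt_delta28 a)).sub
      (continuousAt_phi30_of_openBox hopen)
  have h2 := hQc.eventually_ne hQ
  filter_upwards [h1, h2] with a' h h'
  exact ⟨h.1, h.2, h'⟩

/-- **Rational directions are dense** in `Dir = ℝ⁸`. -/
theorem dense_ratDir : Dense {a : Dir | ∀ i, ∃ q : ℚ, a i = q} := by
  have h : Dense (Set.pi Set.univ fun _ : Fin 8 => Set.range ((↑) : ℚ → ℝ)) :=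
    dense_pi Set.univ fun _ _ => Rat.denseRange_cast
  refine h.mono ?_
  intro a ha i
  obtain ⟨q, hq⟩ := ha i (Set.mem_univ i)
  exact ⟨q, hq.symm⟩

/-- **A rational direction is a positive multiple of an integer direction** (clear the denominators). -/
theorem exists_intDir_of_ratDir {a : Dir} (ha : ∀ i, ∃ q : ℚ, a i = q) :
    ∃ (N : ℕ) (v : Fin 8 → ℤ), 0 < N ∧ (N : ℝ) • a = realDir v := by
  choose q hq using ha
  have hz : ∀ i, ∃ z : ℤ, ((∏ j, (q j).den : ℕ) : ℚ) * q i = z := by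
    intro i
    rw [← Finset.prod_erase_mul _ _ (Finset.mem_univ i)]
    push_cast
    refine ⟨(∏ j ∈ Finset.univ.erase i, ((q j).den : ℤ)) * (q i).num, ?_⟩
    push_cast
    rw [mul_assoc, Rat.den_mul_eq_num]
  choose z hz using hz
  refine ⟨∏ j, (q j).den, z, Finset.prod_pos fun j _ => (q j).den_pos, ?_⟩
  ext i
  rw [Pi.smul_apply, smul_eq_mul, realDir, hq i]
  have h := congrArg (Rat.cast : ℚ → ℝ) (hz i)
  push_cast at h ⊢
  exact h

/-- **Positive scaling preserves the stratum and `γ`.** -/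
theorem stratum_smul {a : Dir} {t : ℝ} (ht : 0 < t)
    (hopen : ∀ j : Fin 7, 0 < sParam a j.succ ∧ sParam a j.succ < sParam a 0) (hreg : Regular a)
    (hQ : C1 a + delta28 a - phi30 a ≠ 0) :
    (∀ j : Fin 7, 0 < sParam (t • a) j.succ ∧ sParam (t • a) j.succ < sParam (t • a) 0) ∧ Regular (t • a) ∧
      C1 (t • a) + delta28 (t • a) - phi30 (t • a) ≠ 0 ∧ gamma (t • a) = gamma a := by
  refine ⟨fun j => ?_, (regular_smul ht a).mpr hreg, ?_, gamma_smul ht a⟩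
  · rw [sParam_smul]
    simp only [Pi.smul_apply, smul_eq_mul]
    exact ⟨mul_pos ht (hopen j).1, mul_lt_mul_of_pos_left (hopen j).2 ht⟩
  · rw [C1_smul ht, delta28_smul ht.le, phi30_smul ht]
    have : t * C1 a + t * delta28 a - t * phi30 a = t * (C1 a + delta28 a - phi30 a) := by ring
    rw [this]
    exact mul_ne_zero ht.ne' hQ

/-- **ON THE REGULAR OPEN-BOX STRATUM A BOUND `γ ≤ γ*` IS DECIDED BY THE INTEGER CLASSES.** If
`γ(realDir v) ≤ γ*` for every integer vector `v` whose direction lies in the open box, is Regular and has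
`C₁ + δ₂₈ − Φ ≠ 0`, then `γ(a) ≤ γ*` at every REAL direction `a` with the same three properties. -/
theorem gamma_le_of_forall_intDir {γs : ℝ}
    (h : ∀ v : Fin 8 → ℤ,
      (∀ j : Fin 7, 0 < sParam (realDir v) j.succ ∧ sParam (realDir v) j.succ < sParam (realDir v) 0) →
      Regular (realDir v) → C1 (realDir v) + delta28 (realDir v) - phi30 (realDir v) ≠ 0 →
      gamma (realDir v) ≤ γs)
    {a : Dir} (hopen : ∀ j : Fin 7, 0 < sParam a j.succ ∧ sParam a j.succ < sParam a 0) (hreg : Regular a)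
    (hQ : C1 a + delta28 a - phi30 a ≠ 0) : gamma a ≤ γs := by
  by_contra hlt
  rw [not_le] at hlt
  have hγ : ∀ᶠ a' in 𝓝 a, γs < gamma a' :=
    (continuousAt_gamma_of_regular hopen hreg hQ).eventually (lt_mem_nhds hlt)
  have hst := eventually_regular_openBox hopen hreg hQ
  obtain ⟨a', hrat, hγ', hbox', hreg', hQ'⟩ := dense_ratDir.inter_nhds_nonempty (hγ.and hst)
  obtain ⟨N, v, hN, hv⟩ := exists_intDir_of_ratDir hrat
  obtain ⟨hbox'', hreg'', hQ'', hγ''⟩ := stratum_smul (Nat.cast_pos.mpr hN) hbox' hreg' hQ'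
  rw [hv] at hbox'' hreg'' hQ'' hγ''
  have hle := h v hbox'' hreg'' hQ''
  rw [hγ''] at hle
  exact absurd hle (not_le.mpr hγ')

/-- **The same inside Brown–Zudilin's cone**: integer classes IN THE CONE decide the bound at every real direction of
the stratum with STRICT non-voidness margin `s₀ < s₁ + ⋯ + s₇` (the closed face `s₀ = Σ sⱼ` is not covered). -/
theorem gamma_le_of_forall_intDir_cone {γs : ℝ}
    (h : ∀ v : Fin 8 → ℤ, realDir v ∈ BZCone →
      (∀ j : Fin 7, 0 < sParam (realDir v) j.succ ∧ sParam (realDir v) j.succ < sParam (realDir v) 0) →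
      Regular (realDir v) → C1 (realDir v) + delta28 (realDir v) - phi30 (realDir v) ≠ 0 →
      gamma (realDir v) ≤ γs)
    {a : Dir} (hopen : ∀ j : Fin 7, 0 < sParam a j.succ ∧ sParam a j.succ < sParam a 0)
    (hmargin : sParam a 0 < ∑ j : Fin 7, sParam a j.succ) (hreg : Regular a)
    (hQ : C1 a + delta28 a - phi30 a ≠ 0) : gamma a ≤ γs := by
  by_contra hlt
  rw [not_le] at hlt
  have hγ : ∀ᶠ a' in 𝓝 a, γs < gamma a' :=
    (continuousAt_gamma_of_regular hopen hreg hQ).eventually (lt_mem_nhds hlt)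
  have hst := eventually_regular_openBox hopen hreg hQ
  -- the strict margin is an open condition
  have hmc : ContinuousAt (fun b : Dir => (∑ j : Fin 7, sParam b j.succ) - sParam b 0) a := by
    refine ((continuous_finsetSum _ fun j _ => ?_).sub ?_).continuousAt
    · exact (continuous_apply _).comp continuous_sParam
    · exact (continuous_apply _).comp continuous_sParam
  have hm : ∀ᶠ a' in 𝓝 a, sParam a' 0 < ∑ j : Fin 7, sParam a' j.succ := by
    have := hmc.eventually (lt_mem_nhds (sub_pos.mpr hmargin))
    filter_upwards [this] with a' ha'
    exact sub_pos.mp ha'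
  obtain ⟨a', hrat, hγ', ⟨hbox', hreg', hQ'⟩, hm'⟩ := dense_ratDir.inter_nhds_nonempty (hγ.and (hst.and hm))
  obtain ⟨N, v, hN, hv⟩ := exists_intDir_of_ratDir hrat
  have hNpos : (0 : ℝ) < N := Nat.cast_pos.mpr hN
  obtain ⟨hbox'', hreg'', hQ'', hγ''⟩ := stratum_smul hNpos hbox' hreg' hQ'
  have hcone : (N : ℝ) • a' ∈ BZCone := by
    refine BZCone_smul hNpos ⟨BZBox_of_openBox hbox', hm'.le⟩
  rw [hv] at hbox'' hreg'' hQ'' hγ'' hcone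
  have hle := h v hcone hbox'' hreg'' hQ''
  rw [hγ''] at hle
  exact absurd hle (not_le.mpr hγ')

end Summit.KontsevichZagierPeriods.Zeta5Search.Barrier.ConeGamma

end
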